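import Literature.Claims.NS.Sghiar2016
import Literature.Analysis.FluidPDE.ParallelShearFlow
import Literature.Analysis.FluidPDE.WholeSpaceIBP
import Literature.Analysis.FluidPDE.VectorCalculus
import Mathlib.Analysis.SpecialFunctions.Trigonometric.Deriv
import Mathlib.Analysis.SpecialFunctions.ExpDeriv
import HarnessLib

/-!
# C127 `Sghiar2016` — refutation certificates against the claim skeleton `Literature.Claims.NS.Sghiar2016`

Text of record: M. Sghiar, HAL hal-01383243 (2016), 8 PDF pp. (PDF p.1 = HAL cover; PDF pages
cited), as typed in `Literature.Claims.NS.Sghiar2016` (typist-7 g2, p485952): `ClaimedTheorem := SolExists ∧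
Step_heat ∧ Step_pressureRel ∧ Step_converse` (the §V Theorem p.7, clauses (a)–(d)),
`claim_of_steps : Step_explicit → Step_heat → Step_pressureRel → Step_converse → ClaimedTheorem`,
clause (a) TRUE by the rest state (`solExists_holds`), Clay only via the declared `ClayDelta`.

This file is typist-7 g2's kernel kit v2 (claims/Sghiar2016/typist7-killkit-Sghiar2016.lean, sha16
698dc32d0ef32e4c, 320 lines), adopted by the refuter of record (refuter-3) with this module docstring
and one-line docstrings on the private helpers (gate lint) and the fully qualified name in the statement of
`not_ClaimedTheorem` (gate dedup), proofs unchanged: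

* `not_Step_heat` — §IV PDF p.5 l.19–24 / Theorem §V p.7 l.25–30 («any solution (u,p) must check …
  ∂uᵢ/∂t = β ∂²uᵢ/∂xᵢ², ∀i»): FAILS for the decaying shear (Stokes) mode `u = (e^{−νt} sin x₂, 0, 0)`,
  `p = 0`, an exact classical solution on `ℝ³ × ℝ` (tree `ParallelShear.isClassicalNSSolutionOn_shear`):
  at `t = 0`, `x = (0, π/2, 0)`, `i = 1`: `∂ₜu₁ = −ν ≠ 0 = ν ∂²u₁/∂x₁²`. LOAD-BEARING: it gives
  `not_ClaimedTheorem` outright.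
* `not_Step_pressureRel` — Theorem §V p.7 («uᵢ² − αpᵢ = fᵢ(t)», scalar reading, both signs): plane
  Couette flow `u = (x₂, 0, 0)`, `p = 0` has `u₁² ∓ p = x₂²`, not constant in `x`.
* `not_Step_explicit` — §III PDF p.5 l.11–14 («we take uᵢ = e^{βt+Σxᵢ} … So we have solutions of the
  Navier–Stokes equation»), the PRINT-EARLIEST typed step: at `β = 1` the displayed field
  `u = e^{t+x₁+x₂+x₃}(1,1,−2)` is not a classical solution for ANY scalar pressure — the momentum
  equation at `t = 0` forces `∇p(0,·) = 2e^{x₁+x₂+x₃}(1,1,−2)` (`∂ₜu = u`, `(u·∇)u = 0`, `Δu = 3u`),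
  whose curl has first component `−6 ≠ 0` at the origin, against `curl ∇p = 0`
  (tree `curl_gradient_eq_zero_holds`). NOT load-bearing: it feeds only clause (a), which holds by
  the rest state (`solExists_but_not_by_explicit : SolExists ∧ ¬ Step_explicit`).
* `not_ClaimedTheorem` — the §V Theorem (typed conjunction) is false.

WHAT THIS IS NOT: not a claim about NS regularity or blow-up; not a claim about any author beyond the
typed locator.
-/

-- the cell's Theorems namespace repeats the summit name (convention); silence the duplicate-namespace linter
set_option linter.dupNamespace false

open Set Function
open scoped ContDiff Laplacian

namespace Summit.NavierStokesRegularity.NavierStokesRegularity.Theorems.Sghiar2016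

open Literature.Claims.NS.Sghiar2016
open Literature.Analysis.FluidPDE

noncomputable section

/-! ## Two exact shear solutions on `ℝ³ × ℝ` (tree `ParallelShear`) -/

/-- The decaying Stokes-mode profile `φ(t, y) = e^{−νt} sin y`. [cite: Acheson1990, §2.3 eq. (2.9)] -/
def stokesProfile (ν : ℝ) (t y : ℝ) : ℝ := Real.exp (-ν * t) * Real.sin y

/-- The plane Couette profile `φ(t, y) = y`. [cite: Acheson1990, §2.3] -/
def couetteProfile (_t y : ℝ) : ℝ := y

/-- The zero shear force is the zero force. [folklore] -/
private theorem shearForce_zero : ParallelShear.shearForce (fun _ _ => (0 : ℝ)) = 0 := by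
  funext t x
  simp [ParallelShear.shearForce]

/-- **The decaying Stokes mode is an exact unforced classical solution on `ℝ³ × ℝ`**
(`∂ₜφ = ν∂²_yφ`). [cite: Acheson1990, §2.3 eq. (2.9)] -/
theorem isClassicalNSSolutionOn_stokesMode (ν : ℝ) :
    IsClassicalNSSolutionOn univ ν 0 (ParallelShear.shearVelocity (stokesProfile ν)) (ParallelShear.shearPressure fun _ => 0) := by
  have h := ParallelShear.isClassicalNSSolutionOn_shear (s := univ) uniqueDiffOn_univ (ν := ν)
    (φ := stokesProfile ν) (g := fun _ _ => (0 : ℝ)) (G := fun _ => (0 : ℝ)) ?_ contDiffOn_const ?_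
  · rwa [shearForce_zero] at h
  · -- joint smoothness of `(t, y) ↦ e^{−νt} sin y`
    have : ContDiff ℝ ∞ (uncurry (stokesProfile ν)) := by
      have h1 : ContDiff ℝ ∞ (fun q : ℝ × ℝ => Real.exp (-ν * q.1) * Real.sin q.2) :=
        (Real.contDiff_exp.comp (contDiff_const.mul contDiff_fst)).mul
          (Real.contDiff_sin.comp contDiff_snd)
      exact h1
    exact this.contDiffOn
  · intro t _ y
    rw [derivWithin_univ]
    -- time derivative
    have ht : HasDerivAt (fun τ => stokesProfile ν τ y) (Real.exp (-ν * t) * (-ν) * Real.sin y) t := by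
      have h1 : HasDerivAt (fun τ : ℝ => -ν * τ) (-ν) t := by
        simpa using (hasDerivAt_id t).const_mul (-ν)
      exact (h1.exp).mul_const _
    -- space derivatives
    have hy1 : deriv (stokesProfile ν t) = fun z => Real.exp (-ν * t) * Real.cos z := by
      funext z
      exact ((Real.hasDerivAt_sin z).const_mul _).deriv
    have hy2 : deriv (deriv (stokesProfile ν t)) y = Real.exp (-ν * t) * (-Real.sin y) := by
      rw [hy1]
      exact ((Real.hasDerivAt_cos y).const_mul _).deriv
    rw [ht.deriv, hy2]
    ring

/-- **Plane Couette flow is an exact unforced classical solution on `ℝ³ × ℝ`.**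
[cite: Acheson1990, §2.3] -/
theorem isClassicalNSSolutionOn_couette (ν : ℝ) :
    IsClassicalNSSolutionOn univ ν 0 (ParallelShear.shearVelocity couetteProfile) (ParallelShear.shearPressure fun _ => 0) := by
  have h := ParallelShear.isClassicalNSSolutionOn_shear (s := univ) uniqueDiffOn_univ (ν := ν)
    (φ := couetteProfile) (g := fun _ _ => (0 : ℝ)) (G := fun _ => (0 : ℝ)) ?_ contDiffOn_const ?_
  · rwa [shearForce_zero] at h
  · exact (contDiff_snd : ContDiff ℝ ∞ fun q : ℝ × ℝ => q.2).contDiffOn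
  · intro t _ y
    rw [derivWithin_univ]
    have h1 : deriv (couetteProfile t) = fun _ => (1 : ℝ) := by
      funext z; exact (hasDerivAt_id z).deriv
    simp [couetteProfile, h1]

/-! ## The kills -/

/-- The test point `(0, π/2, 0)`. [folklore] -/
def xStar : E3 := WithLp.toLp 2 ![(0 : ℝ), Real.pi / 2, 0]

/-- `x*₁ = π/2`. [folklore] -/
private theorem xStar_one : xStar 1 = Real.pi / 2 := by
  simp [xStar]

/-- `(e₀)₁ = 0`. [folklore] -/
private theorem e_zero_one : (e 0 : E3) 1 = 0 := by
  simp [e]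

/-- The first component of the Stokes mode: `u₁(t, x) = e^{−νt} sin x₂`. [folklore] -/
private theorem stokes_comp0 (ν t : ℝ) (x : E3) :
    ParallelShear.shearVelocity (stokesProfile ν) t x 0 = Real.exp (-ν * t) * Real.sin (x 1) := by
  simp [ParallelShear.shearVelocity, stokesProfile]

/-- `∂/∂x₁` of `x ↦ e^{−νt} sin x₂` vanishes identically. [folklore] -/
private theorem fderiv_stokes_comp0_e0 (ν t : ℝ) (y : E3) :
    fderiv ℝ (fun z : E3 => ParallelShear.shearVelocity (stokesProfile ν) t z 0) y (e 0) = 0 := by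
  have hfun : (fun z : E3 => ParallelShear.shearVelocity (stokesProfile ν) t z 0) =
      fun z : E3 => Real.exp (-ν * t) * Real.sin (z 1) := by
    funext z; exact stokes_comp0 ν t z
  rw [hfun]
  have hproj : HasFDerivAt (fun z : E3 => z 1) (EuclideanSpace.proj (1 : Fin 3) : E3 →L[ℝ] ℝ) y :=
    (EuclideanSpace.proj (1 : Fin 3) : E3 →L[ℝ] ℝ).hasFDerivAt
  have hsin : HasFDerivAt (fun z : E3 => Real.sin (z 1))
      (Real.cos (y 1) • (EuclideanSpace.proj (1 : Fin 3) : E3 →L[ℝ] ℝ)) y := by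
    have := (Real.hasDerivAt_sin (y 1)).comp_hasFDerivAt y hproj
    exact this
  have h := hsin.const_mul (Real.exp (-ν * t))
  rw [h.fderiv]
  simp [e_zero_one]

/-- **Step 2 fails** (§IV p.5 l.19–24 / Theorem §V p.7 l.25–30): the Stokes mode at `ν = 1`, `t = 0`,
`x = (0, π/2, 0)`, `i = 1` (index `0`): `∂ₜu₁ = −1` but `ν ∂²u₁/∂x₁² = 0`.
[cite: Sghiar2016, §V Theorem p.7; §IV p.5 l.19–24] -/
theorem not_Step_heat : ¬ Step_heat := by
  intro h
  have key := h 1 univ _ _ one_pos (isClassicalNSSolutionOn_stokesMode 1) 0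
    (by rw [interior_univ]; exact mem_univ _) xStar 0
  -- right-hand side: the inner partial derivative is identically zero
  have hinner : (fun y : E3 => fderiv ℝ (fun z : E3 => ParallelShear.shearVelocity (stokesProfile 1) 0 z 0) y (e 0)) =
      fun _ => (0 : ℝ) := by
    funext y; exact fderiv_stokes_comp0_e0 1 0 y
  have hR : dii (fun y : E3 => ParallelShear.shearVelocity (stokesProfile 1) 0 y 0) 0 xStar = 0 := by
    unfold dii
    rw [hinner]
    simp
  -- left-hand side: `s ↦ e^{−s}` has derivative `−1` at `0`
  have hfunL : (fun s : ℝ => ParallelShear.shearVelocity (stokesProfile 1) s xStar 0) = fun s => Real.exp (-1 * s) := by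
    funext s
    rw [stokes_comp0, xStar_one, Real.sin_pi_div_two, mul_one]
  have hL : deriv (fun s : ℝ => ParallelShear.shearVelocity (stokesProfile 1) s xStar 0) 0 = -1 := by
    rw [hfunL]
    have h1 : HasDerivAt (fun s : ℝ => -1 * s) (-1) 0 := by
      simpa using (hasDerivAt_id (0 : ℝ)).const_mul (-1 : ℝ)
    rw [h1.exp.deriv]
    simp
  rw [hL, hR] at key
  norm_num at key

/-- **Step 3 fails** (Theorem §V p.7 «uᵢ² − αpᵢ = fᵢ(t)», both signs): plane Couette at `ν = 1`,
`t = 0`, `i = 1`: `u₁² ∓ p = x₂²` takes the values `0` at `x = 0` and `π²/4` at `(0, π/2, 0)`.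
[cite: Sghiar2016, §V Theorem p.7; §IV p.5 l.16–18] -/
theorem not_Step_pressureRel : ¬ Step_pressureRel := by
  intro h
  have key := h 1 univ _ _ one_pos (isClassicalNSSolutionOn_couette 1) 0 (mem_univ _) 0
  have hu : ∀ x : E3, ParallelShear.shearVelocity couetteProfile 0 x 0 = x 1 := by
    intro x; simp [ParallelShear.shearVelocity, couetteProfile]
  have hp : ∀ x : E3, ParallelShear.shearPressure (fun _ => (0 : ℝ)) 0 x = 0 := by
    intro x; simp [ParallelShear.shearPressure]
  have hpi : Real.pi / 2 ≠ 0 := by positivity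
  rcases key with ⟨c, hc⟩ | ⟨c, hc⟩
  · have h0 := hc 0
    have h1 := hc xStar
    rw [hu, hp] at h0 h1
    rw [xStar_one] at h1
    simp at h0
    have : (Real.pi / 2) ^ 2 = 0 := by linarith
    exact hpi (pow_eq_zero_iff (n := 2) (by norm_num) |>.1 this)
  · have h0 := hc 0
    have h1 := hc xStar
    rw [hu, hp] at h0 h1
    rw [xStar_one] at h1
    simp at h0
    have : (Real.pi / 2) ^ 2 = 0 := by linarith
    exact hpi (pow_eq_zero_iff (n := 2) (by norm_num) |>.1 this)

/-! ## §III p.5: the displayed explicit field is not a solution for any scalar pressure -/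

/-- The linear functional `ℓ(x) = x₀ + x₁ + x₂`. [folklore] -/
def ell : E3 →L[ℝ] ℝ :=
  (EuclideanSpace.proj (0 : Fin 3) : E3 →L[ℝ] ℝ) + (EuclideanSpace.proj (1 : Fin 3) : E3 →L[ℝ] ℝ) +
    (EuclideanSpace.proj (2 : Fin 3) : E3 →L[ℝ] ℝ)

/-- `ℓ(x) = x₀ + x₁ + x₂`. [folklore] -/
private theorem ell_apply (x : E3) : ell x = x 0 + x 1 + x 2 := by
  simp [ell]

/-- The direction vector `v = (1, 1, −2)` of the displayed field. [cite: Sghiar2016, §III p.5 l.5–14] -/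
def vDir : E3 := WithLp.toLp 2 ![(1 : ℝ), 1, -2]

/-- `v₀ = 1`. [folklore] -/
private theorem vDir_zero : vDir 0 = 1 := by simp [vDir]
/-- `v₁ = 1`. [folklore] -/
private theorem vDir_one : vDir 1 = 1 := by simp [vDir]
/-- `v₂ = −2`. [folklore] -/
private theorem vDir_two : vDir 2 = -2 := by simp [vDir]

/-- `ℓ(v) = 1 + 1 − 2 = 0`. [folklore] -/
private theorem ell_vDir : ell vDir = 0 := by
  rw [ell_apply, vDir_zero, vDir_one, vDir_two]; norm_num

/-- `ℓ(eⱼ) = 1`. [folklore] -/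
private theorem ell_single (j : Fin 3) : ell (EuclideanSpace.single j (1 : ℝ)) = 1 := by
  rw [ell_apply]; fin_cases j <;> simp

/-- The spatial profile `w_c(x) = c·e^{ℓ(x)} (1,1,−2)`. [cite: Sghiar2016, §III p.5 l.13] -/
def wave (c : ℝ) (x : E3) : E3 := (c * Real.exp (ell x)) • vDir

/-- `uExp 1 t = wave (e^t)`. [folklore] -/
private theorem uExp_one_eq (t : ℝ) : uExp 1 t = wave (Real.exp t) := by
  funext x
  simp only [uExp, wave, vDir, ell_apply, one_mul, Real.exp_add]

/-- `D w_c(x) d = (ℓ(d) c e^{ℓ(x)}) (1,1,−2)`. [folklore] -/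
theorem hasFDerivAt_wave (c : ℝ) (x : E3) :
    HasFDerivAt (wave c) (ell.smulRight ((c * Real.exp (ell x)) • vDir)) x := by
  have h1 : HasFDerivAt (fun r : ℝ => (c * Real.exp r) • vDir)
      ((1 : ℝ →L[ℝ] ℝ).smulRight ((c * Real.exp (ell x)) • vDir)) (ell x) :=
    (((Real.hasDerivAt_exp (ell x)).const_mul c).smul_const vDir).hasFDerivAt
  have h2 : HasFDerivAt (fun y : E3 => ell y) ell x := ell.hasFDerivAt
  have h := h1.comp x h2
  refine h.congr_fderiv ?_
  ext d i
  simp [mul_comm]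

/-- `D(wave c)(x) d = (c e^{ℓ(x)} ℓ(d)) • v`. [folklore] -/
theorem fderiv_wave_apply (c : ℝ) (x d : E3) :
    fderiv ℝ (wave c) x d = (ell d * (c * Real.exp (ell x))) • vDir := by
  rw [(hasFDerivAt_wave c x).fderiv]
  simp [smul_smul]

/-- `wave c` is smooth. [folklore] -/
theorem contDiff_wave (c : ℝ) : ContDiff ℝ ∞ (wave c) := by
  unfold wave
  exact (contDiff_const.mul (Real.contDiff_exp.comp ell.contDiff)).smul contDiff_const

/-- `(w·∇)w = 0` (the field points along `(1,1,−2)`, on which `ℓ` vanishes). [folklore] -/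
theorem convect_wave (c : ℝ) (x : E3) : convect (wave c) (wave c) x = 0 := by
  rw [convect_apply, fderiv_wave_apply]
  simp [wave, ell_vDir]

/-- `Δw = 3w` (`ℓ(eⱼ) = 1` for each coordinate direction). [folklore] -/
theorem laplacian_wave (c : ℝ) (x : E3) : (Δ (wave c)) x = (3 * (c * Real.exp (ell x))) • vDir := by
  rw [laplacian_eq_sum_fderiv_fderiv (EuclideanSpace.basisFun (Fin 3) ℝ)
    ((contDiff_wave c).of_le (by norm_cast)) x]
  have hinner : ∀ i : Fin 3,
      (fun y : E3 => fderiv ℝ (wave c) y (EuclideanSpace.basisFun (Fin 3) ℝ i)) = wave c := by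
    intro i; funext y
    rw [fderiv_wave_apply]
    have : ell (EuclideanSpace.basisFun (Fin 3) ℝ i) = 1 := by
      rw [EuclideanSpace.basisFun_apply]; exact ell_single i
    rw [this, one_mul]; rfl
  simp_rw [hinner]
  rw [Fin.sum_univ_three, fderiv_wave_apply, fderiv_wave_apply, fderiv_wave_apply]
  have hb : ∀ i : Fin 3, ell (EuclideanSpace.basisFun (Fin 3) ℝ i) = 1 := fun i => by
    rw [EuclideanSpace.basisFun_apply]; exact ell_single i
  rw [hb, hb, hb, ← add_smul, ← add_smul]
  congr 1; ring

/-- The time derivative of `uExp 1` at `t = 0`: `∂ₜu(0,x) = w₁(x)`. [folklore] -/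
theorem timeDeriv_uExp_zero (x : E3) : timeDerivWithin univ (uExp 1) 0 x = wave 1 x := by
  rw [timeDerivWithin_apply, derivWithin_univ]
  have hfun : (fun s : ℝ => uExp 1 s x) = fun s => (Real.exp s * Real.exp (ell x)) • vDir := by
    funext s
    rw [uExp_one_eq]; simp [wave]
  rw [hfun]
  have h : HasDerivAt (fun s : ℝ => (Real.exp s * Real.exp (ell x)) • vDir)
      ((Real.exp 0 * Real.exp (ell x)) • vDir) 0 :=
    ((Real.hasDerivAt_exp 0).mul_const _).smul_const vDir
  rw [h.deriv]
  simp [wave]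

/-- **Step 1 fails** (§III p.5 l.11–14): no scalar pressure makes the displayed field (β = 1) a
classical solution — the momentum equation at `t = 0` would force `∇p(0,·) = 2e^{ℓ}(1,1,−2)`, which
is not curl-free. [cite: Sghiar2016, §III p.5 l.11–14] -/
theorem not_Step_explicit : ¬ Step_explicit := by
  intro h
  obtain ⟨p, hsol⟩ := h 1 one_pos
  -- the pressure gradient at time 0 is forced
  have hgrad : gradient (p 0) = wave 2 := by
    funext x
    have hm := hsol.momentum 0 (mem_univ _) x
    rw [timeDeriv_uExp_zero, uExp_one_eq, Real.exp_zero, convect_wave, laplacian_wave, one_smul] at hm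
    simp only [Pi.zero_apply, add_zero] at hm
    -- hm : wave 1 x = (3 * (1 * exp)) • v - gradient (p 0) x
    have : gradient (p 0) x = (3 * (1 * Real.exp (ell x))) • vDir - wave 1 x := by
      rw [hm]; abel
    rw [this]
    simp only [wave, one_mul]
    rw [← sub_smul]
    congr 1; ring
  -- curl of a gradient vanishes …
  have hp2 : ContDiff ℝ 2 (p 0) := (hsol.contDiff_pressure (mem_univ 0)).of_le (by norm_cast)
  have hzero := curl_gradient_eq_zero_holds (p 0) hp2 0
  rw [hgrad] at hzero
  -- … but the first component of `curl (wave 2)` at the origin is `−6`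
  have h0 := congrArg (fun w : E3 => w 0) hzero
  simp only [curl, fderiv_wave_apply, ell_single, PiLp.zero_apply] at h0
  simp [vDir, ell_apply] at h0
  norm_num at h0

/-- **The §V Theorem as typed is false** (its clause (b) fails). [cite: Sghiar2016, §V Theorem p.7] -/
theorem not_ClaimedTheorem : ¬ Literature.Claims.NS.Sghiar2016.ClaimedTheorem :=
  fun h => not_Step_heat h.2.1

/-- Clause (a)'s printed support also fails (`solExists_of_explicit` cannot be fed), although clause
(a) itself is true (`solExists_holds`). [cite: Sghiar2016, §III p.5 l.11–14; §V p.7 l.17] -/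
theorem solExists_but_not_by_explicit : SolExists ∧ ¬ Step_explicit :=
  ⟨solExists_holds, not_Step_explicit⟩

end

end Summit.NavierStokesRegularity.NavierStokesRegularity.Theorems.Sghiar2016

-- WHAT THIS IS NOT: not a claim about NS regularity or blow-up; not a claim about any author beyond the typed locator.
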